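import Summits.BirchSwinnertonDyer.BirchSwinnertonDyer.Theorems.Rank2Observatory2DescClCurveCertE2SQSound
import HarnessLib

/-!
# BirchSwinnertonDyer — rank ≥ 2 observatory: KERNEL-2DESC-CL, SQ4 (part B) — SUPPORT, SIGNS AND `log ord` OVER A TOTALLY SPLIT `q`

HONEST FRAMING: per-curve certified theorems and census instruments; no claim on BSD in rank ≥ 2.

Continuation of `…ClCurveCertE2SQSound` (split for the 400-line file limit; design
`…/kernel-2desc-cl/v2/generics/cq/PLAN-g51.md`): § 4 support of a checked family element and the signs at the three
real places (landed `…ClCurveCertE2Sound` / `…ClRealCertE2Defs` texts over the SQ3 record types); § 5 (NEW in the split-`q`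
variant) **`log ord_{W_j}(x) = famL3 j`** for the three primes above `q` — the element `q` has `ord = 1` at each
(`log_valuation_WQ_natCast`, SQ1), a generic element has the certified order at its carrier `W_c` by the norm squeeze over
`U_q = {W_0, W_1, W_2}` (`log_valuation_WQ_eq_of_not_mem`, SQ1; the two `invCert` data exclude the other two) and `ord = 0`
at the two others (`valuation_eq_one_of_invCert`); § 6 the code primes of the support (`codePrime3`).

Sorry-free; axioms `propext`, `Classical.choice`, `Quot.sound`.
[cite: Cassels1991LecturesEllipticCurves, §15] [cite: Marcus2018, Ch. 2, Thm. 4; Ch. 3, Thm. 22] [cite: Cohen1993, §4.8.2]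
-/

set_option linter.dupNamespace false

noncomputable section

open scoped Classical NumberField nonZeroDivisors

open Literature.NumberTheory.NumberFields Polynomial Module NumberField IsDedekindDomain Ideal

namespace Summit.BirchSwinnertonDyer.BirchSwinnertonDyer.Rank2Observatory.TwoDescCl

open TwoDescCubic ClFieldCert

section Sound

variable {K : Type*} [Field K] [NumberField K] {θ : K} {F : ClFieldCertE2} {cc : ClCurveCertE3} {f : FamEntry3}

/-! ### Support of a family element -/

/-- **Support**: every prime containing the family element `x` contains `M = D · q`.
[cite: Cassels1991LecturesEllipticCurves, §15] -/
theorem supp_of_famCheckE3 (hθ : aeval θ (MonicCubic.poly F.fe.base.a F.fe.base.b F.fe.base.c) = 0)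
    (h3 : finrank ℚ K = 3) (hE : F.fe.checkCoreE3 = true) (hK : F.checkConst = true)
    (hpr : F.fe.primeListE.Forall Nat.Prime) (hcodes : ∀ bc ∈ cc.codes, codeClause3 F cc bc = true)
    (htvD : twoViewCheck F.fe.base.a F.fe.base.b F.fe.base.c F.fe.u F.fe.d F.m₁ F.m₂ cc.XD cc.YD = true)
    (h : famCheckE3 F cc f = true) :
    ∀ v : HeightOneSpectrum (𝓞 K), eltOf3 F hθ hE f.X f.Y ∈ v.asIdeal →
      eltOf3 F hθ hE cc.XD cc.YD * ((F.fe.base.q : ℕ) : 𝓞 K) ∈ v.asIdeal := by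
  intro v hv
  obtain ⟨hXv, hYv⟩ := avatars_mem3 hθ hE hK (tv_of_famCheckE3 h) v hv
  obtain ⟨pe, hpe, hpv⟩ :=
    exists_prime_of_mem3 hθ h3 hE (normFormZ_ne_of_famCheckE3 h) (natAbs_of_famCheckE3 h) v hXv
  rcases dispatch_sound3 (cc := cc) hθ h3 hE hK hpr (dispatch_of_famCheckE3 h pe hpe) v hpv hXv hYv with
    hq | ⟨C, hmem, -, -, hw, hm₁⟩ | ⟨C, hmem, -, -, hw, hm₂⟩
  · exact Ideal.mul_mem_left _ _ hq
  · obtain ⟨bc, hbc, hbc1⟩ := List.mem_map.mp hmem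
    obtain ⟨-, -, hmc⟩ := codeClause3_true (hcodes bc hbc) (by rw [hbc1])
    have hC : bc.1.2 = C := by rw [hbc1]
    rw [hC] at hmc
    have hXD : lin hθ cc.XD.1 cc.XD.2.1 cc.XD.2.2 ∈ v.asIdeal := lin_mem_of_memCode hθ v hw cc.XD hmc
    exact Ideal.mul_mem_right _ _
      ((mem_iff_of_natCast_mul_eq v hm₁ (m₁_mul_eltOf3 hθ hE hK htvD)).mpr hXD)
  · obtain ⟨bc, hbc, hbc1⟩ := List.mem_map.mp hmem
    obtain ⟨-, -, hmc⟩ := codeClause3_false (hcodes bc hbc) (by rw [hbc1])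
    have hC : bc.1.2 = C := by rw [hbc1]
    rw [hC] at hmc
    have hYD : lin (F.fe.aeval_eta3 hθ hE) cc.YD.1 cc.YD.2.1 cc.YD.2.2 ∈ v.asIdeal :=
      lin_mem_of_memCode (F.fe.aeval_eta3 hθ hE) v hw cc.YD hmc
    exact Ideal.mul_mem_right _ _
      ((mem_iff_of_natCast_mul_eq v hm₂ (m₂_mul_eltOf3 hθ hE hK htvD)).mpr hYD)

/-! ### Sign, real non-vanishing -/

/-- **Sign of a checked family element at the real place** (read on `X`, as `m₁ > 0`). [folklore] -/
theorem sign_iff_of_famCheckE3 (hθ : aeval θ (MonicCubic.poly F.fe.base.a F.fe.base.b F.fe.base.c) = 0)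
    (ρ : K →+* ℝ) (hlo : ((F.fe.base.lo : ℚ) : ℝ) < ρ θ) (hhi : ρ θ < ((F.fe.base.hi : ℚ) : ℝ))
    (h0 : 0 ≤ F.fe.base.lo) (hE : F.fe.checkCoreE3 = true) (hK : F.checkConst = true)
    (h : famCheckE3 F cc f = true) :
    (f.sg = true ↔ ρ (algebraMap (𝓞 K) K (eltOf3 F hθ hE f.X f.Y)) < 0) := by
  have h1 := sign_iff_of_signCond hθ ρ h0 hlo hhi (signCond_of_famCheckE3 h)
  rw [rho_eltOf3 hθ hE hK (tv_of_famCheckE3 h) ρ] at h1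
  have hm : (0 : ℝ) < F.m₁ := Nat.cast_pos.mpr (F.m₁_pos hK)
  rw [h1]
  constructor
  · intro hneg
    by_contra hc
    push Not at hc
    nlinarith
  · intro hneg
    exact mul_neg_of_pos_of_neg hm hneg

/-- A checked family element is non-zero at the real place. [folklore] -/
theorem rho_ne_zero_of_famCheckE3 (hθ : aeval θ (MonicCubic.poly F.fe.base.a F.fe.base.b F.fe.base.c) = 0)
    (ρ : K →+* ℝ) (hlo : ((F.fe.base.lo : ℚ) : ℝ) < ρ θ) (hhi : ρ θ < ((F.fe.base.hi : ℚ) : ℝ))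
    (h0 : 0 ≤ F.fe.base.lo) (hE : F.fe.checkCoreE3 = true) (hK : F.checkConst = true)
    (h : famCheckE3 F cc f = true) : ρ (algebraMap (𝓞 K) K (eltOf3 F hθ hE f.X f.Y)) ≠ 0 := by
  have h1 := rho_lin_ne_zero_of_signCond hθ ρ h0 hlo hhi (signCond_of_famCheckE3 h)
  rw [rho_eltOf3 hθ hE hK (tv_of_famCheckE3 h) ρ] at h1
  exact (mul_ne_zero_iff.mp h1).2



/-! ## 3. Signs at the three real places (split-`q` core) -/

/-- **Sign of a two-view element at a real place from an interval sign clause on `X`** (`true` = negative):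
`ρ(X) = m₁·ρ(x)` with `m₁ > 0`. [folklore] -/
theorem sign_iff_eltOf3_of_signCond (hθ : aeval θ (MonicCubic.poly F.fe.base.a F.fe.base.b F.fe.base.c) = 0)
    (ρ : K →+* ℝ) {lo hi : ℚ} (h0 : 0 ≤ lo) (hlo : ((lo : ℚ) : ℝ) < ρ θ) (hhi : ρ θ < ((hi : ℚ) : ℝ))
    (hE : F.fe.checkCoreE3 = true) (hK : F.checkConst = true) {X Y : ℤ × ℤ × ℤ}
    (htv : twoViewCheck F.fe.base.a F.fe.base.b F.fe.base.c F.fe.u F.fe.d F.m₁ F.m₂ X Y = true) {sg : Bool}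
    (h : signCond lo hi X sg = true) :
    (sg = true ↔ ρ (algebraMap (𝓞 K) K (eltOf3 F hθ hE X Y)) < 0) := by
  have h1 := sign_iff_of_signCond hθ ρ h0 hlo hhi h
  rw [rho_eltOf3 hθ hE hK htv ρ] at h1
  have hm : (0 : ℝ) < F.m₁ := Nat.cast_pos.mpr (F.m₁_pos hK)
  rw [h1]
  constructor
  · intro hneg
    by_contra hc
    push Not at hc
    nlinarith
  · intro hneg
    exact mul_neg_of_pos_of_neg hm hneg

/-- A two-view element with an interval sign clause does not vanish at the place. [folklore] -/
theorem rho_eltOf3_ne_zero_of_signCond (hθ : aeval θ (MonicCubic.poly F.fe.base.a F.fe.base.b F.fe.base.c) = 0)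
    (ρ : K →+* ℝ) {lo hi : ℚ} (h0 : 0 ≤ lo) (hlo : ((lo : ℚ) : ℝ) < ρ θ) (hhi : ρ θ < ((hi : ℚ) : ℝ))
    (hE : F.fe.checkCoreE3 = true) (hK : F.checkConst = true) {X Y : ℤ × ℤ × ℤ}
    (htv : twoViewCheck F.fe.base.a F.fe.base.b F.fe.base.c F.fe.u F.fe.d F.m₁ F.m₂ X Y = true) {sg : Bool}
    (h : signCond lo hi X sg = true) : ρ (algebraMap (𝓞 K) K (eltOf3 F hθ hE X Y)) ≠ 0 := by
  have h1 := rho_lin_ne_zero_of_signCond hθ ρ h0 hlo hhi h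
  rw [rho_eltOf3 hθ hE hK htv ρ] at h1
  exact (mul_ne_zero_iff.mp h1).2

variable {G : ClFieldCertRE2} {ccr : ClCurveCertE3R} {f : FamEntry3}

/-- The complex clause of a checked entry. -/
theorem famCheckE3_of_famCheckE3R (h : famCheckE3R G ccr f = true) : famCheckE3 G.toE2 ccr.cc f = true := by
  simp only [famCheckE3R, Bool.and_eq_true] at h
  exact h.1.1

/-- **Sign bits at the three places** of a checked entry (`true` = negative). [folklore] -/
theorem sgAt3_iff_of_famCheckE3R
    (hθ : aeval θ (MonicCubic.poly G.toE2.fe.base.a G.toE2.fe.base.b G.toE2.fe.base.c) = 0)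
    (ρ : Fin 3 → (K →+* ℝ)) (h0 : ∀ k, 0 ≤ (G.fre.re.I k).1)
    (hρ : ∀ k, (((G.fre.re.I k).1 : ℚ) : ℝ) < ρ k θ ∧ ρ k θ < (((G.fre.re.I k).2 : ℚ) : ℝ))
    (hE : G.toE2.fe.checkCoreE3 = true) (hK : G.toE2.checkConst = true) (h : famCheckE3R G ccr f = true)
    (k : Fin 3) :
    (sgAt3 ccr f k = true ↔ ρ k (algebraMap (𝓞 K) K (eltOf3 G.toE2 hθ hE f.X f.Y)) < 0) := by
  have htv := tv_of_famCheckE3 (famCheckE3_of_famCheckE3R h)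
  have h1 := signCond_of_famCheckE3 (famCheckE3_of_famCheckE3R h)
  simp only [famCheckE3R, Bool.and_eq_true] at h
  obtain ⟨⟨-, h2⟩, h3⟩ := h
  have hk0 := h0 k
  obtain ⟨hlo, hhi⟩ := hρ k
  fin_cases k <;> simp only [ClFieldCertR.I, sgAt3, Fin.isValue, Fin.zero_eta, Fin.mk_one, Fin.reduceFinMk,
    ↓reduceIte, Fin.reduceEq] at hk0 hlo hhi ⊢
  · exact sign_iff_eltOf3_of_signCond hθ _ hk0 hlo hhi hE hK htv h1
  · exact sign_iff_eltOf3_of_signCond hθ _ hk0 hlo hhi hE hK htv h2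
  · exact sign_iff_eltOf3_of_signCond hθ _ hk0 hlo hhi hE hK htv h3

/-- A checked entry does not vanish at any place. [folklore] -/
theorem rho_ne_zero_of_famCheckE3R
    (hθ : aeval θ (MonicCubic.poly G.toE2.fe.base.a G.toE2.fe.base.b G.toE2.fe.base.c) = 0)
    (ρ : Fin 3 → (K →+* ℝ)) (h0 : ∀ k, 0 ≤ (G.fre.re.I k).1)
    (hρ : ∀ k, (((G.fre.re.I k).1 : ℚ) : ℝ) < ρ k θ ∧ ρ k θ < (((G.fre.re.I k).2 : ℚ) : ℝ))
    (hE : G.toE2.fe.checkCoreE3 = true) (hK : G.toE2.checkConst = true) (h : famCheckE3R G ccr f = true)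
    (k : Fin 3) : ρ k (algebraMap (𝓞 K) K (eltOf3 G.toE2 hθ hE f.X f.Y)) ≠ 0 := by
  have htv := tv_of_famCheckE3 (famCheckE3_of_famCheckE3R h)
  have h1 := signCond_of_famCheckE3 (famCheckE3_of_famCheckE3R h)
  simp only [famCheckE3R, Bool.and_eq_true] at h
  obtain ⟨⟨-, h2⟩, h3⟩ := h
  have hk0 := h0 k
  obtain ⟨hlo, hhi⟩ := hρ k
  fin_cases k <;> simp only [ClFieldCertR.I, Fin.isValue, Fin.zero_eta, Fin.mk_one, Fin.reduceFinMk,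
    ↓reduceIte, Fin.reduceEq] at hk0 hlo hhi ⊢
  · exact rho_eltOf3_ne_zero_of_signCond hθ _ hk0 hlo hhi hE hK htv h1
  · exact rho_eltOf3_ne_zero_of_signCond hθ _ hk0 hlo hhi hE hK htv h2
  · exact rho_eltOf3_ne_zero_of_signCond hθ _ hk0 hlo hhi hE hK htv h3


/-! ## 4. The element `q`; norms -/

/-- The element `q` of the family is literally `q`. -/
theorem eltOf3_eq_q (hθ : aeval θ (MonicCubic.poly F.fe.base.a F.fe.base.b F.fe.base.c) = 0)
    (hE : F.fe.checkCoreE3 = true) (hK : F.checkConst = true) (h : famCheckE3 F cc f = true) (h1 : f.kind = 1) :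
    eltOf3 F hθ hE f.X f.Y = ((F.fe.base.q : ℕ) : 𝓞 K) := by
  have hk := kind_of_famCheckE3 h
  unfold famKindCheck3 at hk
  rw [if_pos h1, decide_eq_true_eq] at hk
  have hX : lin hθ f.X.1 f.X.2.1 f.X.2.2 = (F.m₁ : 𝓞 K) * ((F.fe.base.q : ℕ) : 𝓞 K) := by
    rw [hk]
    simp only
    rw [lin_const hθ]
    push_cast
    ring
  exact mul_left_cancel₀ (m₁_ne_zero_O hK) ((m₁_mul_eltOf3 hθ hE hK (tv_of_famCheckE3 h)).trans hX)

/-- `|N(q)| = q³ · 1` (for the `(−1, −1)` valuation lemma). -/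
theorem natAbs_norm_q3 (hθ : aeval θ (MonicCubic.poly F.fe.base.a F.fe.base.b F.fe.base.c) = 0)
    (h3 : finrank ℚ K = 3) (hE : F.fe.checkCoreE3 = true) :
    (Algebra.norm ℤ ((F.fe.base.q : ℕ) : 𝓞 K)).natAbs = F.fe.base.q ^ 3 * 1 := by
  have e := natAbs_norm_lin_coords (F.fe.base.irreducible_of_reg3 (F.fe.checkReg3_of_coreE3 hE)) hθ h3
    ((F.fe.base.q : ℤ), 0, 0)
  simp only at e
  rw [lin_q hθ] at e
  rw [e]
  simp [normFormZ, Int.natAbs_pow]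


/-- `|N(X(α))| = q ^ e · m`, `q ∤ m` from an `ordCheck` (split-`q` registry core). [folklore] -/
theorem natAbs_norm_of_ordCheck_reg3 {fc : ClFieldCert} (hθ : aeval θ (MonicCubic.poly fc.a fc.b fc.c) = 0)
    (h3 : finrank ℚ K = 3) (hR : fc.checkReg3 = true) {g : ℤ × ℤ × ℤ} {e : ℕ}
    (h : ordCheck fc.q (normFormZ fc.a fc.b fc.c g.1 g.2.1 g.2.2).natAbs e = true) :
    (Algebra.norm ℤ (lin hθ g.1 g.2.1 g.2.2 : 𝓞 K)).natAbs =
        fc.q ^ e * ((normFormZ fc.a fc.b fc.c g.1 g.2.1 g.2.2).natAbs / fc.q ^ e) ∧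
      ¬ fc.q ∣ (normFormZ fc.a fc.b fc.c g.1 g.2.1 g.2.2).natAbs / fc.q ^ e := by
  simp only [ordCheck, decide_eq_true_eq] at h
  rw [natAbs_norm_lin_coords (fc.irreducible_of_reg3 hR) hθ h3]
  exact h

/-! ## 5. `log ord` at the three primes above `q` -/

/-- **`log ord_{W_j}(x) = famL3 j`** for a checked two-view family element over a totally split `q`: the element
`q` has `ord = 1` at each `W_j`; a generic element has the certified order `e` at its carrier `W_c` (norm squeeze
over `U_q`, the other two primes excluded by `invCert`) and `ord = 0` at the other two.
[cite: Marcus2018, Ch. 3, Thm. 22] [cite: Cohen1993, §4.8.2] -/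
theorem log_WQ_of_famCheckE3 (hθ : aeval θ (MonicCubic.poly F.fe.base.a F.fe.base.b F.fe.base.c) = 0)
    (h3 : finrank ℚ K = 3) (hE : F.fe.checkCoreE3 = true) (hK : F.checkConst = true)
    (hpr : F.fe.primeListE.Forall Nat.Prime) (h : famCheckE3 F cc f = true) (j : Fin 3) :
    WithZero.log ((F.fe.base.WQ hθ h3 (F.fe.checkReg3_of_coreE3 hE) (F.fe.base_primeList hpr) j).valuation K
      ((eltOf3 F hθ hE f.X f.Y : 𝓞 K) : K)) = famL3 j f := by
  have hR := F.fe.checkReg3_of_coreE3 hE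
  have hprb := F.fe.base_primeList hpr
  -- the two indices of `Fin 3` other than `c` (= `Literature…Fin3.eq_or_eq_of_ne`; kept local, no percolation import)
  have key : ∀ c j : Fin 3, j ≠ c → j = c + 1 ∨ j = c + 2 := by decide
  unfold famL3
  by_cases h1 : f.kind = 1
  · rw [if_pos h1, eltOf3_eq_q hθ hE hK h h1]
    exact log_valuation_WQ_natCast hθ h3 hR hprb j
  rw [if_neg h1]
  have hk := kind_of_famCheckE3 h
  unfold famKindCheck3 at hk
  rw [if_neg h1, Bool.and_eq_true, Bool.and_eq_true] at hk
  obtain ⟨⟨hinv2, hinv3⟩, hord⟩ := hk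
  have hdisp := (alpha_dispatch hθ (F.fe.d_pos3 hE) (F.fe.aeval_eta3 hθ hE) (F.bezout_of_const hK)
    (tv_of_famCheckE3 h) (F.fe.base.WQ hθ h3 hR hprb j) (q_mem_WQ hθ h3 hR hprb j) (F.coprime_q hK)).2
  unfold eltOf3
  rw [hdisp]
  by_cases hj : j = f.c
  · rw [if_pos hj]
    obtain ⟨hN, hm⟩ := natAbs_norm_of_ordCheck_reg3 hθ h3 hR hord
    refine log_valuation_WQ_eq_of_not_mem hθ h3 hR hprb j (fun j' hj' => ?_) hN hm
    rcases key _ _ (hj ▸ hj' : j' ≠ f.c) with rfl | rfl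
    · exact lin_not_mem_of_invCert hθ _ (WQ_asIdeal hθ h3 hR hprb _) hinv2
    · exact lin_not_mem_of_invCert hθ _ (WQ_asIdeal hθ h3 hR hprb _) hinv3
  · rw [if_neg hj]
    rcases key _ _ hj with rfl | rfl
    · rw [valuation_eq_one_of_invCert hθ _ (WQ_asIdeal hθ h3 hR hprb _) hinv2, WithZero.log_one]
    · rw [valuation_eq_one_of_invCert hθ _ (WQ_asIdeal hθ h3 hR hprb _) hinv3, WithZero.log_one]

/-! ## 6. The code primes of the support -/

variable (F) in
/-- The height-one prime of a tagged support code (split-`q` reading). -/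
def codePrime3 (hθ : aeval θ (MonicCubic.poly F.fe.base.a F.fe.base.b F.fe.base.c) = 0) (h3 : finrank ℚ K = 3)
    (hE : F.fe.checkCoreE3 = true) (hpr : F.fe.primeListE.Forall Nat.Prime) (bc : (Bool × PCode) × FamEntry3) :
    HeightOneSpectrum (𝓞 K) :=
  if bc.1.1 = true then codePrimeR3 hθ h3 (F.fe.checkReg3_of_coreE3 hE) (F.fe.base_primeList hpr) bc.1.2
  else F.fe.codePrimeEta3 hθ h3 hE hpr bc.1.2

end Sound

end Summit.BirchSwinnertonDyer.BirchSwinnertonDyer.Rank2Observatory.TwoDescCl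

end
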